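import Literature.Computability.QuantumComplexity.ForrelationThm25Sign
import Literature.Computability.QuantumComplexity.ForrelationThm25Lexer
import Literature.Computability.Complexity.StackStrings
import Literature.Computability.Complexity.TokenStreams
import HarnessLib

/-!
# Aaronson–Ambainis Theorem 25 in `FP`, II: stack-program bricks and the codes of the shapes

Topic `Literature/Computability/QuantumComplexity`; second file towards the residual named fact
`AaronsonAmbainis2018_thm25_sign_encodeFP` (`ForrelationThm25Sign.lean`): the instance map of
AA Theorem 25 over the sign basis is in `FP` (S. Aaronson, A. Ambainis, *Forrelation*,
SIAM J. Comput. 47 (2018) = arXiv:1411.5729, §6, Thm. 25, proof p. 27). The interpreter of the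
token stream of `ForrelationThm25Lexer.lean` is a structured stack program (`Com`,
`StackPrograms.lean`, verified in the style of `TokenStreams.lean`); this file supplies its
register-generic routines and the bit patterns it prints.

* **Routines** over any register type (`Function.update` specifications, exact costs):
  `pushList` (print a literal word), `emitRep` (print every bit of a numeral register `m` times,
  non-destructively), `incR` (binary increment of a numeral register, the carry pass of
  `TokConv.inc`; `encodeNat c ↦ encodeNat (c + 1)`), the flag utilities `setFlag`, `clearFlag`,
  `toggle` and the two-flag counter modulo `4`, `inc4` (`inc4F`, `inc4F_iterate`).
* **Codes of the shapes.** In the code of a FORRELATION instance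
  (`KForrelationInstance.encode`: `⟨N, ⟨k, encodeCodeList (circuit codes)⟩⟩` — the same right-nested
  `boolPair` fold as `encList` — circuits by
  `encodeCircuit`, Arora–Barak 2009, §6.1) the `B₂`-circuit of a shape `s : SignShape N`
  (`1`, `z_a`, `z_a z_b`, `z_a z_b z_c`; `SignShape.toCircuit`) contributes the list element
  `rep 2 (encodeCircuit s.toCircuit) ++ 01`. These elements are fixed bit patterns around the
  binary wire numerals repeated sixteenfold (four nested pairings): `codeNoneL`, `codeOneL u`,
  `codeTwoL u v`, `codeThreeL u v w`, with `shapeBits_*` the identities; `shapeBits` is the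
  element of a shape and `shapesBits` of a list of shapes.

## References

* S. Aaronson, A. Ambainis, *Forrelation: a problem that optimally separates quantum from
  classical computing*, SIAM J. Comput. 47 (2018) 982–1038; arXiv:1411.5729, §6, Thm. 25.
* S. Arora, B. Barak, *Computational Complexity: A Modern Approach*, CUP 2009, §0.1 (pairing,
  binary numerals), §6.1 (descriptions of circuits), §1.3.
* D. E. Knuth, *The Art of Computer Programming*, Vol. 2, 3rd ed. 1998, §4.3.1 (increment with
  carry propagation).
* T. Nipkow, G. Klein, *Concrete Semantics with Isabelle/HOL*, Springer 2014, Ch. 7.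
-/

namespace Literature.Computability.QuantumComplexity

open _root_.Computability Complexity Complexity.Com Cryptography Thm25Lex

namespace Thm25Asm

/-! ### Register-generic routines -/

section Generic

variable {ι : Type} [DecidableEq ι]

/-- Print the literal word `l` on register `o`, first bit first (so the register, read top
down, holds `l` reversed on top of its old contents). Opposite-order sibling of
`Complexity.Com.pushList` (`StackNumeric.lean`, result `l ++ old`; not imported here). [folklore] -/
def pushList (o : ι) : List Bool → Com ι
  | [] => Com.skip
  | b :: l => Com.push o b ;; pushList o l

/-- `pushList` prints its word in `|l|` steps. [folklore] -/
theorem runs_pushList (o : ι) : ∀ (l : List Bool) (R : Regs ι),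
    Runs (pushList o l) R (Function.update R o (l.reverse ++ R o)) l.length
  | [], R => (Runs.skip R).of_eq (by simp) (by simp)
  | b :: l, R => by
    have h1 : Runs (Com.push o b) R (Function.update R o (b :: R o)) 1 := Runs.push o b R
    have h2 := runs_pushList o l (Function.update R o (b :: R o))
    refine (h1.seq h2).of_eq ?_ (by simp; omega)
    simp

/-- The bit-repeating loop of `emitRep`. [folklore] -/
def emitRepLoop (src t o : ι) (m : ℕ) : Com ι :=
  Com.loop src (pushList o (List.replicate m true) ;; Com.push t true)
    (pushList o (List.replicate m false) ;; Com.push t false)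

/-- `emitRep src t o m`: print every bit of `src` (top first) `m` times on `o`, keeping `src`
(its bits are parked on the empty scratch register `t` and poured back). [folklore] -/
def emitRep (src t o : ι) (m : ℕ) : Com ι :=
  emitRepLoop src t o m ;; Com.pour t src

/-- The loop of `emitRep`: `src` is drained, `o` receives the repeated bits, `t` the bits.
[folklore] -/
theorem runs_emitRepLoop {src t o : ι} (hso : src ≠ o) (hst : src ≠ t) (hto : t ≠ o) (m : ℕ) :
    ∀ (w : List Bool) (R : Regs ι), R src = w →
      Runs (emitRepLoop src t o m) R
        (Function.update (Function.update (Function.update R src []) o ((rep m w).reverse ++ R o)) t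
          (w.reverse ++ R t)) (w.length * (m + 3) + 1)
  | [], R, h => by
    refine (Runs.loop_nil _ _ h).of_eq ?_ (by simp)
    ext i : 1
    simp only [Function.update_apply, rep_nil, List.reverse_nil, List.nil_append]
    split_ifs <;> simp_all
  | b :: w, R, h => by
    have hbody : ∀ c : Bool, Runs (pushList o (List.replicate m c) ;; Com.push t c) (Function.update R src (w))
        (Function.update (Function.update (Function.update R src w) o (List.replicate m c ++ R o)) t (c :: R t))
        (m + 1) := by
      intro c
      have h1 := runs_pushList o (List.replicate m c) (Function.update R src w)
      have h2 := Runs.push t c (Function.update (Function.update R src w) o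
        ((List.replicate m c).reverse ++ Function.update R src w o))
      refine (h1.seq h2).of_eq ?_ (by simp)
      ext i : 1
      simp only [Function.update_apply, List.reverse_replicate]
      split_ifs <;> simp_all
    have hih : ∀ c : Bool, Runs (emitRepLoop src t o m)
        (Function.update (Function.update (Function.update R src w) o (List.replicate m c ++ R o)) t (c :: R t))
        (Function.update (Function.update (Function.update R src []) o ((rep m (c :: w)).reverse ++ R o)) t
          ((c :: w).reverse ++ R t)) (w.length * (m + 3) + 1) := by
      intro c
      refine (runs_emitRepLoop hso hst hto m w _ (by simp [hso, hst])).of_eq ?_ le_rfl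
      ext i : 1
      simp only [Function.update_apply, rep_cons, List.reverse_append, List.reverse_replicate, List.reverse_cons,
        List.append_assoc, List.singleton_append]
      split_ifs <;> simp_all
    have hcost : (b :: w).length * (m + 3) + 1 = (m + 1) + 2 + (w.length * (m + 3) + 1) := by
      simp only [List.length_cons]; ring
    rw [hcost]
    cases b
    · exact Runs.loop_false h (hbody false) (hih false)
    · exact Runs.loop_true h (hbody true) (hih true)

/-- **`emitRep` prints `rep m (src)` on `o` and keeps `src`**, in `(m + 6)|src| + 2` steps,
provided the scratch register `t` is empty. [folklore] -/
theorem runs_emitRep {src t o : ι} (hso : src ≠ o) (hst : src ≠ t) (hto : t ≠ o) (m : ℕ)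
    (R : Regs ι) (ht : R t = []) :
    Runs (emitRep src t o m) R (Function.update R o ((rep m (R src)).reverse ++ R o))
      ((R src).length * (m + 3) + 1 + (3 * (R src).length + 1)) := by
  have h1 := runs_emitRepLoop hso hst hto m (R src) R rfl
  set R₁ := Function.update (Function.update (Function.update R src []) o ((rep m (R src)).reverse ++ R o)) t
    ((R src).reverse ++ R t)
  have h2 := runs_pour hst.symm R₁
  have hR₁t : R₁ t = (R src).reverse := by simp [R₁, ht]
  refine (h1.seq h2).of_eq ?_ (by rw [hR₁t, List.length_reverse])
  ext i : 1
  simp only [R₁, Function.update_apply, ht, List.append_nil]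
  split_ifs <;> simp_all

/-- One step of the carry pass (generic registers; cf. `TokConv.incBody`). [cite: KnuthTAOCP2, §4.3.1] -/
def incBody (tmp flg : ι) (b : Bool) : Com ι :=
  Com.pop flg (Com.push tmp (!b) ;; bif b then Com.push flg true else Com.skip) Com.skip (Com.push tmp b)

/-- The carry loop. [folklore] -/
def incLoop (ctr tmp flg : ι) : Com ι := Com.loop ctr (incBody tmp flg true) (incBody tmp flg false)

/-- **Binary increment** of the numeral register `ctr` (least significant bit on top), using the
empty scratch `tmp` and flag `flg`. [folklore] -/
def incR (ctr tmp flg : ι) : Com ι :=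
  Com.push flg true ;; incLoop ctr tmp flg ;; Com.pop flg (Com.push tmp true) Com.skip Com.skip ;; Com.pour tmp ctr

/-- One carry step. [folklore] -/
theorem runs_incBody {tmp flg : ι} (htf : tmp ≠ flg) (b cr : Bool) (R : Regs ι) (hflg : R flg = flag cr) :
    Runs (incBody tmp flg b) R
      (Function.update (Function.update R tmp ((b ^^ cr) :: R tmp)) flg (flag (b && cr))) 4 := by
  cases cr
  · refine (Runs.pop_nil _ _ hflg (Runs.push tmp b R)).of_eq ?_ (by omega)
    ext i : 1
    simp only [Function.update_apply]
    split_ifs <;> simp_all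
  · have hk : R flg = true :: [] := hflg
    cases b
    · refine (Runs.pop_true' _ _ hk rfl ((Runs.push tmp true _).seq (Runs.skip _))).of_eq ?_ (by omega)
      ext i : 1
      simp only [Function.update_apply]
      split_ifs <;> simp_all
    · refine (Runs.pop_true' _ _ hk rfl ((Runs.push tmp false _).seq (Runs.push flg true _))).of_eq ?_ (by omega)
      ext i : 1
      simp only [Function.update_apply]
      split_ifs <;> simp_all

/-- The carry loop: `ctr` drained, the written bits (reversed) on `tmp`, the carry in `flg`.
[folklore] -/
theorem runs_incLoop {ctr tmp flg : ι} (hct : ctr ≠ tmp) (hcf : ctr ≠ flg) (htf : tmp ≠ flg) :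
    ∀ (w : List Bool) (cr : Bool) (R : Regs ι), R ctr = w → R flg = flag cr →
      Runs (incLoop ctr tmp flg) R
        (Function.update (Function.update (Function.update R ctr []) tmp ((TokConv.ib cr w).reverse ++ R tmp)) flg
          (flag (TokConv.co cr w))) (6 * w.length + 1)
  | [], cr, R, hc, hf => by
    refine (Runs.loop_nil _ _ hc).of_eq ?_ (by simp)
    ext i : 1
    simp only [Function.update_apply, TokConv.ib, TokConv.co, List.reverse_nil, List.nil_append]
    split_ifs <;> simp_all
  | b :: w, cr, R, hc, hf => by
    have h1 : Runs (incBody tmp flg b) (Function.update R ctr w)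
        (Function.update (Function.update (Function.update R ctr w) tmp ((b ^^ cr) :: R tmp)) flg (flag (b && cr))) 4 := by
      have := runs_incBody htf b cr (Function.update R ctr w) (by simp [hcf.symm, hf])
      simpa [hct.symm] using this
    have h2 := runs_incLoop hct hcf htf w (b && cr)
      (Function.update (Function.update (Function.update R ctr w) tmp ((b ^^ cr) :: R tmp)) flg (flag (b && cr)))
      (by simp [hct, hcf]) (by simp)
    have e : Function.update (Function.update (Function.update
          (Function.update (Function.update (Function.update R ctr w) tmp ((b ^^ cr) :: R tmp)) flg (flag (b && cr)))
          ctr []) tmp ((TokConv.ib (b && cr) w).reverse ++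
            Function.update (Function.update (Function.update R ctr w) tmp ((b ^^ cr) :: R tmp)) flg (flag (b && cr)) tmp))
          flg (flag (TokConv.co (b && cr) w)) =
        Function.update (Function.update (Function.update R ctr []) tmp ((TokConv.ib cr (b :: w)).reverse ++ R tmp)) flg
          (flag (TokConv.co cr (b :: w))) := by
      ext i : 1
      simp only [Function.update_apply, TokConv.ib, TokConv.co, List.reverse_cons, List.append_assoc,
        List.singleton_append]
      split_ifs <;> simp_all
    rw [e] at h2
    have hcost : 6 * (b :: w).length + 1 = 4 + 2 + (6 * w.length + 1) := by simp only [List.length_cons]; ring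
    rw [hcost]
    cases b
    · exact Runs.loop_false hc h1 h2
    · exact Runs.loop_true hc h1 h2

/-- **`incR` replaces `encodeNat c` by `encodeNat (c + 1)`** in at most `9|encodeNat c| + 9`
steps. [folklore] -/
theorem runs_incR {ctr tmp flg : ι} (hct : ctr ≠ tmp) (hcf : ctr ≠ flg) (htf : tmp ≠ flg) (c : ℕ)
    (R : Regs ι) (hc : R ctr = encodeNat c) (ht : R tmp = []) (hf : R flg = []) :
    Runs (incR ctr tmp flg) R (Function.update R ctr (encodeNat (c + 1))) (9 * (encodeNat c).length + 9) := by
  set w := encodeNat c with hw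
  have h0 : Runs (Com.push flg true) R (Function.update R flg (flag true)) 1 :=
    Runs.push' (by simp [hf])
  have h1 := runs_incLoop hct hcf htf w true (Function.update R flg (flag true)) (by simp [hcf, hc]) (by simp)
  set R₁ := Function.update (Function.update (Function.update (Function.update R flg (flag true)) ctr []) tmp
    ((TokConv.ib true w).reverse ++ Function.update R flg (flag true) tmp)) flg (flag (TokConv.co true w)) with hR₁
  have hR₁tmp : R₁ tmp = (TokConv.ib true w).reverse := by simp [R₁, htf, ht]
  set R₂ := Function.update (Function.update R₁ flg []) tmp ((TokConv.incRes true w).reverse) with hR₂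
  have h2 : Runs (Com.pop flg (Com.push tmp true) Com.skip Com.skip) R₁ R₂ 3 := by
    cases hco : TokConv.co true w
    · have hk : R₁ flg = [] := by simp [R₁, hco]
      refine (Runs.pop_nil _ _ hk (Runs.skip _)).of_eq ?_ (by omega)
      ext i : 1
      simp only [hR₂, Function.update_apply, TokConv.incRes, hco, flag_false, List.append_nil]
      split_ifs <;> simp_all
    · have hk : R₁ flg = true :: [] := by simp [R₁, hco]
      refine (Runs.pop_true' _ _ hk rfl (Runs.push tmp true _)).of_eq ?_ (by omega)
      ext i : 1
      simp only [hR₂, Function.update_apply, TokConv.incRes, hco, flag_true, List.reverse_append,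
        List.reverse_singleton, List.singleton_append]
      split_ifs <;> simp_all
  have h3 := runs_pour (a := tmp) (b := ctr) hct.symm R₂
  have hR₂tmp : R₂ tmp = (TokConv.incRes true w).reverse := by simp [R₂]
  have hR₂ctr : R₂ ctr = [] := by simp [R₂, R₁, hct, hcf]
  refine (h0.seq (h1.seq (h2.seq h3))).of_eq ?_ ?_
  · ext i : 1
    rw [TokConv.encodeNat_succ_eq_incRes, ← hw]
    simp only [hR₂, hR₁, Function.update_apply, ht]
    split_ifs <;> simp_all
  · rw [hR₂tmp, List.length_reverse]
    have := TokConv.length_incRes_le true w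
    have : w.length = (encodeNat c).length := by rw [hw]
    omega

/-- Set a flag register (of length `≤ 1`) to `[true]`. [folklore] -/
def setFlag (f : ι) : Com ι := Com.pop f (Com.push f true) (Com.push f true) (Com.push f true)

/-- `setFlag` on a flag. [folklore] -/
theorem runs_setFlag (f : ι) (R : Regs ι) (b : Bool) (h : R f = flag b) :
    Runs (setFlag f) R (Function.update R f [true]) 3 := by
  cases b
  · exact (Runs.pop_nil _ _ h (Runs.push' (by simp [h]))).of_eq rfl (by omega)
  · have hk : R f = true :: [] := h
    exact (Runs.pop_true' _ _ hk rfl (Runs.push' (by simp))).of_eq rfl (by omega)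

/-- Clear a flag register. [folklore] -/
def clearFlag (f : ι) : Com ι := Com.pop f Com.skip Com.skip Com.skip

/-- `clearFlag` on a flag. [folklore] -/
theorem runs_clearFlag (f : ι) (R : Regs ι) (b : Bool) (h : R f = flag b) :
    Runs (clearFlag f) R (Function.update R f []) 2 := by
  cases b
  · exact (Runs.pop_nil _ _ h (Runs.skip _)).of_eq (by rw [← flag_false, ← h, Function.update_eq_self]) (by omega)
  · have hk : R f = true :: [] := h
    exact (Runs.pop_true' _ _ hk rfl (Runs.skip _)).of_eq rfl (by omega)

/-- Toggle a flag register. [folklore] -/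
def toggle (f : ι) : Com ι := Com.pop f Com.skip Com.skip (Com.push f true)

/-- `toggle` on a flag. [folklore] -/
theorem runs_toggle (f : ι) (R : Regs ι) (b : Bool) (h : R f = flag b) :
    Runs (toggle f) R (Function.update R f (flag (!b))) 3 := by
  cases b
  · exact (Runs.pop_nil _ _ h (Runs.push' (by simp [h]))).of_eq rfl (by omega)
  · have hk : R f = true :: [] := h
    exact (Runs.pop_true' _ _ hk rfl (Runs.skip _)).of_eq rfl (by omega)

/-- The two-flag counter modulo `4` (bit `0` in `p0`, bit `1` in `p1`): increment. [folklore] -/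
def inc4 (p0 p1 : ι) : Com ι :=
  ifFlag p0 (clearFlag p0 ;; ifFlag p1 (clearFlag p1) (setFlag p1)) (setFlag p0)

/-- The increment modulo `4` on the two bits. [folklore] -/
def inc4F (q : Bool × Bool) : Bool × Bool := (!q.1, bif q.1 then !q.2 else q.2)

/-- `inc4` realises `inc4F`, in at most `11` steps. [folklore] -/
theorem runs_inc4 {p0 p1 : ι} (hp : p0 ≠ p1) (R : Regs ι) (b0 b1 : Bool) (h0 : R p0 = flag b0)
    (h1 : R p1 = flag b1) :
    Runs (inc4 p0 p1) R (Function.update (Function.update R p0 (flag (inc4F (b0, b1)).1)) p1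
      (flag (inc4F (b0, b1)).2)) 11 := by
  cases b0
  · refine (runs_ifFlag_false _ h0 (runs_setFlag p0 R false h0)).of_eq ?_ (by omega)
    ext i : 1
    simp only [inc4F, Function.update_apply, Bool.not_false, flag_true, cond_false]
    split_ifs <;> simp_all
  · have hc := runs_clearFlag p0 R true h0
    have hin : Runs (ifFlag p1 (clearFlag p1) (setFlag p1)) (Function.update R p0 [])
        (Function.update (Function.update R p0 []) p1 (flag (!b1))) 6 := by
      refine runs_ifFlag (b := b1) (by simp [hp.symm, h1]) (fun hb => ?_) (fun hb => ?_)
      · subst hb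
        exact (runs_clearFlag p1 _ true (by simp [hp.symm, h1])).of_eq rfl (by omega)
      · subst hb
        exact (runs_setFlag p1 _ false (by simp [hp.symm, h1])).of_eq rfl (by omega)
    refine (runs_ifFlag_true _ h0 (hc.seq hin)).of_eq ?_ (by omega)
    ext i : 1
    simp only [inc4F, Function.update_apply, Bool.not_true, flag_false, cond_true]

/-- The counter modulo `4` after `j` increments from zero: bit `0` is the parity of `j`, bit
`1` tells whether `j mod 4 ≥ 2`. [folklore] -/
theorem inc4F_iterate (j : ℕ) :
    inc4F^[j] (false, false) = (decide (j % 2 = 1), decide (2 ≤ j % 4)) := by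
  induction j with
  | zero => simp
  | succ j ih =>
    rw [Function.iterate_succ_apply', ih, inc4F]
    have h4 : j % 4 < 4 := Nat.mod_lt _ (by omega)
    have hsucc : (j + 1) % 4 = (j % 4 + 1) % 4 := by omega
    have hpar : j % 2 = (j % 4) % 2 := by omega
    have hpar' : (j + 1) % 2 = ((j % 4 + 1) % 4) % 2 := by omega
    ext <;> simp only [hsucc, hpar, hpar'] <;> interval_cases (j % 4) <;> decide

end Generic

/-! ### The printed codes of the shapes -/

/-- Merging adjacent constant runs (inside a concatenation). [folklore] -/
theorem replicate_append_replicate_append (m k : ℕ) (b : Bool) (l : List Bool) :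
    List.replicate m b ++ (List.replicate k b ++ l) = List.replicate (m + k) b ++ l := by
  rw [← List.append_assoc, ← List.replicate_add]

/-- Merging adjacent constant runs (at the end). [folklore] -/
theorem replicate_append_replicate (m k : ℕ) (b : Bool) :
    List.replicate m b ++ List.replicate k b = List.replicate (m + k) b := (List.replicate_add ..).symm

/-- The list element contributed by a shape to the code of a FORRELATION instance: the doubled
circuit code followed by the pair separator. [cite: AroraBarak2009, §6.1 (descriptions of circuits)] -/
def shapeBits {N : ℕ} (s : SignShape N) : List Bool := rep 2 (encodeCircuit s.toCircuit) ++ [false, true]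

/-- The list elements of a list of shapes. [cite: AroraBarak2009, §6.1 (descriptions of circuits)] -/
def shapesBits {N : ℕ} (L : List (SignShape N)) : List Bool := L.flatMap shapeBits

/-- `shapesBits` of nil. [folklore] -/
@[simp] theorem shapesBits_nil {N : ℕ} : shapesBits ([] : List (SignShape N)) = [] := rfl
/-- `shapesBits` of cons. [folklore] -/
@[simp] theorem shapesBits_cons {N : ℕ} (s : SignShape N) (L : List (SignShape N)) :
    shapesBits (s :: L) = shapeBits s ++ shapesBits L := rfl
/-- `shapesBits` of a concatenation. [folklore] -/
@[simp] theorem shapesBits_append {N : ℕ} (L L' : List (SignShape N)) :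
    shapesBits (L ++ L') = shapesBits L ++ shapesBits L' := by simp [shapesBits, List.flatMap_append]

/-- The element of the constant shape `1` (the one-gate constant-`false` circuit), `48` bits.
[cite: AroraBarak2009, §6.1 (descriptions of circuits)] -/
def codeNoneL : List Bool :=
  List.replicate 24 false ++ List.replicate 8 true ++ List.replicate 4 false ++ List.replicate 4 true ++
    List.replicate 2 false ++ List.replicate 4 true ++ [false, true]

/-- The element of the projection shape `z_a` (the gate-free circuit with output wire `a`),
around the numeral `u` of `a`. [cite: AroraBarak2009, §6.1 (descriptions of circuits)] -/
def codeOneL (u : List Bool) : List Bool :=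
  List.replicate 2 false ++ List.replicate 2 true ++ List.replicate 2 false ++ rep 2 u ++ [false, true]

/-- Leading pattern of an AND-gate circuit code (truth table `0001`, start of the wire list).
[cite: AroraBarak2009, §6.1 (descriptions of circuits)] -/
def pre2 : List Bool :=
  List.replicate 48 false ++ List.replicate 16 true ++ List.replicate 8 false ++ List.replicate 8 true ++
    List.replicate 16 false

/-- Pattern between the two wire numerals of an AND gate. [cite: AroraBarak2009, §6.1 (descriptions of circuits)] -/
def mid2 : List Bool := List.replicate 8 false ++ List.replicate 8 true ++ List.replicate 16 false

/-- Trailing pattern of the one-gate AND circuit (end of wire list, end of gate list, output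
gate `0`). [cite: AroraBarak2009, §6.1 (descriptions of circuits)] -/
def post2 : List Bool :=
  List.replicate 8 false ++ List.replicate 8 true ++ List.replicate 4 false ++ List.replicate 4 true ++
    List.replicate 2 false ++ List.replicate 4 true ++ [false, true]

/-- The element of the shape `z_a z_b` (one AND gate on the input wires `a`, `b`), around the
numerals `u`, `v` of `a`, `b`. [cite: AroraBarak2009, §6.1 (descriptions of circuits)] -/
def codeTwoL (u v : List Bool) : List Bool := pre2 ++ rep 16 u ++ (mid2 ++ rep 16 v ++ post2)

/-- Pattern between the first and the second AND gate of the shape `z_a z_b z_c`.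
[cite: AroraBarak2009, §6.1 (descriptions of circuits)] -/
def mid3 : List Bool :=
  List.replicate 8 false ++ List.replicate 8 true ++ List.replicate 4 false ++ List.replicate 4 true ++ pre2

/-- Trailing pattern of the two-gate AND circuit (back-reference to gate `0`, end of lists,
output gate `1`). [cite: AroraBarak2009, §6.1 (descriptions of circuits)] -/
def post3 : List Bool :=
  List.replicate 8 false ++ List.replicate 24 true ++ List.replicate 8 false ++ List.replicate 8 true ++
    List.replicate 4 false ++ List.replicate 4 true ++ List.replicate 2 false ++ List.replicate 6 true ++ [false, true]

/-- The element of the shape `z_a z_b z_c` (gates `z_b ∧ z_c`, then `z_a ∧ gate₀`), around the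
numerals `u`, `v`, `w` of `a`, `b`, `c` (printed in the order `v`, `w`, `u`).
[cite: AroraBarak2009, §6.1 (descriptions of circuits)] -/
def codeThreeL (u v w : List Bool) : List Bool :=
  pre2 ++ rep 16 v ++ (mid2 ++ rep 16 w ++ (mid3 ++ rep 16 u ++ post3))

/-- The truth table of the binary AND gate is `0001`. [folklore] -/
theorem truthTable_and2 : MetaComplexity.truthTable (fun v : Fin 2 → Bool => v 0 && v 1) = [false, false, false, true] := by
  decide

/-- The truth table of the constant-`false` gate of arity `0` is `0`. [folklore] -/
theorem truthTable_const0 : MetaComplexity.truthTable (fun _ : Fin 0 → Bool => false) = [false] := by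
  decide

/-- **The code of the constant shape.** [cite: AroraBarak2009, §6.1 (descriptions of circuits)] -/
theorem shapeBits_none {N : ℕ} : shapeBits (SignShape.none : SignShape N) = codeNoneL := by
  simp only [shapeBits, SignShape.toCircuit, Circuit.const, encodeCircuit, encodeGate, encodeCodeList, encodeWire,
    List.map_cons, List.map_nil, List.foldr_cons, List.foldr_nil, List.ofFn_zero, truthTable_const0,
    boolPair_eq_rep, rep_append, rep_cons, rep_nil, rep_replicate, List.append_assoc, List.append_nil,
    TokConv.encodeNat_zero', replicate_append_replicate_append, Nat.reduceMul, Nat.reduceAdd, codeNoneL]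

/-- **The code of a projection shape.** [cite: AroraBarak2009, §6.1 (descriptions of circuits)] -/
theorem shapeBits_one {N : ℕ} (a : Fin N) : shapeBits (SignShape.one a) = codeOneL (encodeNat a) := by
  simp only [shapeBits, SignShape.toCircuit, Circuit.input, encodeCircuit, encodeCodeList, encodeWire,
    List.map_nil, List.foldr_nil, boolPair_eq_rep, rep_append, rep_cons, rep_nil, List.append_assoc, List.nil_append,
    codeOneL]

/-- **The code of a two-bit shape.** [cite: AroraBarak2009, §6.1 (descriptions of circuits)] -/
theorem shapeBits_two {N : ℕ} (a b : Fin N) : shapeBits (SignShape.two a b) = codeTwoL (encodeNat a) (encodeNat b) := by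
  simp only [shapeBits, SignShape.toCircuit, FewBits.and2Circuit, encodeCircuit, encodeGate, encodeCodeList, encodeWire,
    List.map_cons, List.map_nil, List.foldr_cons, List.foldr_nil, List.ofFn_succ, List.ofFn_zero,
    Matrix.cons_val_zero, Matrix.cons_val_succ, Matrix.cons_val_fin_one, truthTable_and2,
    boolPair_eq_rep, rep_append, rep_rep, rep_cons, rep_nil, rep_replicate, List.append_assoc, List.append_nil,
    TokConv.encodeNat_zero', replicate_append_replicate_append, Nat.reduceMul, Nat.reduceAdd,
    codeTwoL, pre2, mid2, post2]

/-- **The code of a three-bit shape.** [cite: AroraBarak2009, §6.1 (descriptions of circuits)] -/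
theorem shapeBits_three {N : ℕ} (a b c : Fin N) :
    shapeBits (SignShape.three a b c) = codeThreeL (encodeNat a) (encodeNat b) (encodeNat c) := by
  have h1 : encodeNat 1 = [true] := by decide
  simp only [shapeBits, SignShape.toCircuit, FewBits.and3Circuit, encodeCircuit, encodeGate, encodeCodeList, encodeWire,
    List.map_cons, List.map_nil, List.foldr_cons, List.foldr_nil, List.ofFn_succ, List.ofFn_zero,
    Matrix.cons_val_zero, Matrix.cons_val_succ, Matrix.cons_val_fin_one, truthTable_and2,
    boolPair_eq_rep, rep_append, rep_rep, rep_cons, rep_nil, rep_replicate, List.append_assoc, List.append_nil,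
    TokConv.encodeNat_zero', h1, replicate_append_replicate_append, Nat.reduceMul, Nat.reduceAdd,
    codeThreeL, pre2, mid2, mid3, post3]

/-- Length of the constant element. [folklore] -/
theorem length_codeNoneL : codeNoneL.length = 48 := rfl
/-- Length of the projection element. [folklore] -/
theorem length_codeOneL (u : List Bool) : (codeOneL u).length = 2 * u.length + 8 := by
  simp only [codeOneL, List.length_append, List.length_replicate, length_rep, List.length_cons, List.length_nil]; omega
/-- Length of the two-bit element. [folklore] -/
theorem length_codeTwoL (u v : List Bool) : (codeTwoL u v).length = 16 * u.length + 16 * v.length + 160 := by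
  simp only [codeTwoL, pre2, mid2, post2, List.length_append, List.length_replicate, length_rep, List.length_cons,
    List.length_nil]; omega
/-- Length of the three-bit element. [folklore] -/
theorem length_codeThreeL (u v w : List Bool) :
    (codeThreeL u v w).length = 16 * u.length + 16 * v.length + 16 * w.length + 314 := by
  simp only [codeThreeL, pre2, mid2, mid3, post3, List.length_append, List.length_replicate, length_rep,
    List.length_cons, List.length_nil]; omega

end Thm25Asm

end Literature.Computability.QuantumComplexity
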